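import Literature.LinearAlgebra.Matrix.SimultaneousTriangularization
import Literature.LinearAlgebra.Matrix.CommutatorNilpotent

/-!
# `GrenetZeon.DualUnipotentThreeHalves` (stmt-ValiantsHypothesis-24318), stub (c) — census door (R8) in FULL form:
# RADJAVI'S TRACE CRITERION for simultaneous triangularisability, and the exchangeability lemma with a full flag

leafhand-val-grenetzeon-2 gen29 (30th hand), 2026-09-01; closes door (R8) of the tree census
`Cruxes/DualUnipotentThreeHalves/CENSUS-leafhand2-g28-bipartite-graft.md` §6 («common-eigenvector form DONE by name
(p843456); full-flag / simultaneous-family form open (M)»).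

WHY.  The 29th hand's exchangeability lemma `BipartiteGraft.exists_common_eigenvector_of_commutator_traceOrth` stops at a
COMMON EIGENVECTOR of a pair `(X, Y)` whose commutator is trace-orthogonal to the unital algebra `ℂ⟨X, Y⟩`.  The tree already
holds McCOY'S THEOREM (`Literature.LinearAlgebra.Matrix.SimultaneousTriangularization.forall_isNilpotent_iff_exists_isUnit`,
Horn–Johnson 2.4.8.6/2.4.8.7): a family is simultaneously triangularisable by one non-singular matrix iff every
`p(A)·(A_kA_ℓ − A_ℓA_k)` is nilpotent.  Trace-orthogonality of the generator commutators to the generated algebra gives exactly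
McCoy's hypothesis (every power of `p(A)·[A_k, A_ℓ]` is `[A_k, A_ℓ]` times an element of the algebra, so all its power traces
vanish, Horn–Johnson 2.4.P10 `isNilpotent_of_forall_trace_pow_eq_zero`), and conversely.  Hence, BY NAME:

* `isNilpotent_lift_mul_commutator_of_traceOrth` — trace-orthogonal generator commutators ⇒ McCoy's condition (a).
* ★ `exists_isUnit_conj_iff_traceOrth` — RADJAVI'S TRACE CRITERION (family form): `A : ι → M_m(ℂ)` is simultaneously upper
  triangularisable by ONE non-singular `S` **iff** `tr((A_kA_ℓ − A_ℓA_k)·u) = 0` for all `k, ℓ` and all `u ∈ ℂ⟨A⟩`.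
* ★ `exists_isUnit_conj_iff_trace_permutable` — subalgebra form: a unital matrix algebra `𝒜 ≤ M_m(ℂ)` is triangularisable iff
  its trace is PERMUTABLE, `tr(abu) = tr(bau)` for all `a, b, u ∈ 𝒜` (Radjavi–Rosenthal Thm. 2.2.1 «triangularizable iff trace is permutable», in the algebra-level 3-letter form of the characteristic-0 remark after its proof; transpositions of adjacent letters generate all permutations).
* ★ `exists_isUnit_conj_pair_of_commutator_traceOrth` — the EXCHANGEABILITY LEMMA IN FULL: `tr((XY − YX)·u) = 0` for all
  `u ∈ ℂ⟨X, Y⟩` ⇒ ONE non-singular `S` makes `S⁻¹XS` and `S⁻¹YS` upper triangular (a common full flag), with converse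
  `commutator_traceOrth_of_exists_isUnit_conj_pair` and the iff `exists_isUnit_conj_pair_iff_commutator_traceOrth`.

Reading for the crux (census §4 (E), caveat unchanged): every pair `(X, Y)` with COUNT-DETERMINED word traces lives in ONE Borel
pair, so the MOR-type inflations `X ⊗ g + Y ⊗ h` over such pairs are block-band CHEAP species of (c); a pairwise-exchangeable
linear FAMILY need not be triangularisable as a family (`M_p × 0`), and the trace criterion says precisely what the family
version needs: all generator commutators trace-orthogonal to the algebra of the WHOLE family.

Honest framing.  Helper (`--supports stmt-ValiantsHypothesis-24318`); nothing here proves (c) `LongMassSlowLawInv`, S3,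
24318, 8062 or `VP ≠ VNP` — all OPEN / NOT proved.  No definitions, no sorry, standard axioms.
[cite: HornJohnson2013, Thm. 2.4.8.7 (McCoy) p0162–0164 and 2.4.P10 p0171] [cite: RadjaviRosenthal2000, Thm. 2.2.1 «triangularizable iff trace is permutable» (§2.2 Permutable Trace, p. 33) and the characteristic-0 remark after its proof]
-/

set_option linter.dupNamespace false
set_option autoImplicit false

namespace Summit.ValiantsHypothesis.ValiantsHypothesis.Theorems.GrenetZeon.TraceTriangularisable

open Matrix
open scoped BigOperators
open Literature.LinearAlgebra.Matrix (isNilpotent_of_forall_trace_pow_eq_zero)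
open Literature.LinearAlgebra.Matrix.SimultaneousTriangularization (forall_isNilpotent_iff_exists_isUnit)

variable {m : ℕ} {ι : Type*}

/-! ## §1 Trace-orthogonal commutators give McCoy's condition -/

/-- If every generator commutator `A_kA_ℓ − A_ℓA_k` is trace-orthogonal to the unital algebra `ℂ⟨A⟩` generated by the family,
then `p(A)·(A_kA_ℓ − A_ℓA_k)` is nilpotent for every noncommutative polynomial `p` — McCoy's condition (a): all power traces of
`p(A)·C` are of the form `tr(C·u)`, `u ∈ ℂ⟨A⟩`. [cite: HornJohnson2013, Thm. 2.4.8.7 and 2.4.P10] -/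
theorem isNilpotent_lift_mul_commutator_of_traceOrth (A : ι → Matrix (Fin m) (Fin m) ℂ)
    (h : ∀ k l, ∀ u ∈ Algebra.adjoin ℂ (Set.range A), Matrix.trace ((A k * A l - A l * A k) * u) = 0)
    (p : FreeAlgebra ℂ ι) (k l : ι) :
    IsNilpotent (FreeAlgebra.lift ℂ A p * (A k * A l - A l * A k)) := by
  set 𝒜 := Algebra.adjoin ℂ (Set.range A) with h𝒜
  set C := A k * A l - A l * A k with hCdef
  set P := FreeAlgebra.lift ℂ A p with hPdef
  have hP : P ∈ 𝒜 := by
    rw [h𝒜, Algebra.adjoin_range_eq_range_freeAlgebra_lift]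
    exact ⟨p, rfl⟩
  have hA : ∀ i, A i ∈ 𝒜 := fun i => Algebra.subset_adjoin ⟨i, rfl⟩
  have hC : C ∈ 𝒜 :=
    Subalgebra.sub_mem _ (Subalgebra.mul_mem _ (hA k) (hA l)) (Subalgebra.mul_mem _ (hA l) (hA k))
  refine isNilpotent_of_forall_trace_pow_eq_zero _ fun s hs _ => ?_
  obtain ⟨t, rfl⟩ := Nat.exists_eq_succ_of_ne_zero hs.ne'
  rw [pow_succ', Matrix.mul_assoc, Matrix.trace_mul_comm, Matrix.mul_assoc]
  exact h k l _ (Subalgebra.mul_mem _ (Subalgebra.pow_mem _ (Subalgebra.mul_mem _ hP hC) t) hP)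

/-! ## §2 Radjavi's trace criterion (family form and subalgebra form) -/

/-- Hard direction: trace-orthogonal generator commutators ⇒ ONE non-singular `S` makes every `S⁻¹A_kS` upper triangular
(McCoy's theorem, by name). [cite: HornJohnson2013, Thm. 2.4.8.6–2.4.8.7] -/
theorem exists_isUnit_conj_of_traceOrth (A : ι → Matrix (Fin m) (Fin m) ℂ)
    (h : ∀ k l, ∀ u ∈ Algebra.adjoin ℂ (Set.range A), Matrix.trace ((A k * A l - A l * A k) * u) = 0) :
    ∃ S : Matrix (Fin m) (Fin m) ℂ, IsUnit S ∧ ∀ k, (S⁻¹ * A k * S).BlockTriangular id :=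
  (forall_isNilpotent_iff_exists_isUnit A).1 (isNilpotent_lift_mul_commutator_of_traceOrth A h)

/-- Easy direction: if ONE non-singular `S` makes every `S⁻¹A_kS` upper triangular, then every generator commutator is
trace-orthogonal to `ℂ⟨A⟩` (`u = p(A)` and `p(A)·[A_k, A_ℓ]` is nilpotent, hence traceless). [cite: HornJohnson2013, Thm. 2.4.8.7 (b) ⇒ (a)] -/
theorem traceOrth_of_exists_isUnit_conj (A : ι → Matrix (Fin m) (Fin m) ℂ)
    (h : ∃ S : Matrix (Fin m) (Fin m) ℂ, IsUnit S ∧ ∀ k, (S⁻¹ * A k * S).BlockTriangular id) :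
    ∀ k l, ∀ u ∈ Algebra.adjoin ℂ (Set.range A), Matrix.trace ((A k * A l - A l * A k) * u) = 0 := by
  intro k l u hu
  rw [Algebra.adjoin_range_eq_range_freeAlgebra_lift] at hu
  obtain ⟨p, rfl⟩ := hu
  have hnil := (forall_isNilpotent_iff_exists_isUnit A).2 h p k l
  rw [Matrix.trace_mul_comm]
  exact (Matrix.isNilpotent_trace_of_isNilpotent hnil).eq_zero

/-- ★ **RADJAVI'S TRACE CRITERION (family form).**  A family `A : ι → M_m(ℂ)` is simultaneously upper triangularisable by ONE
non-singular matrix iff every generator commutator `A_kA_ℓ − A_ℓA_k` is trace-orthogonal to the unital algebra `ℂ⟨A⟩`.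
[cite: HornJohnson2013, Thm. 2.4.8.7] [cite: RadjaviRosenthal2000, Thm. 2.2.1] -/
theorem exists_isUnit_conj_iff_traceOrth (A : ι → Matrix (Fin m) (Fin m) ℂ) :
    (∃ S : Matrix (Fin m) (Fin m) ℂ, IsUnit S ∧ ∀ k, (S⁻¹ * A k * S).BlockTriangular id) ↔
      ∀ k l, ∀ u ∈ Algebra.adjoin ℂ (Set.range A), Matrix.trace ((A k * A l - A l * A k) * u) = 0 :=
  ⟨traceOrth_of_exists_isUnit_conj A, exists_isUnit_conj_of_traceOrth A⟩

/-- ★ **RADJAVI'S TRACE CRITERION (subalgebra form): triangularisable ⟺ permutable trace.**  A unital matrix algebra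
`𝒜 ≤ M_m(ℂ)` is simultaneously upper triangularisable by ONE non-singular matrix iff `tr(a·b·u) = tr(b·a·u)` for all
`a, b, u ∈ 𝒜`. [cite: RadjaviRosenthal2000, Thm. 2.2.1 (§2.2 Permutable Trace)] [cite: HornJohnson2013, Thm. 2.4.8.7] -/
theorem exists_isUnit_conj_iff_trace_permutable (𝒜 : Subalgebra ℂ (Matrix (Fin m) (Fin m) ℂ)) :
    (∃ S : Matrix (Fin m) (Fin m) ℂ, IsUnit S ∧ ∀ a ∈ 𝒜, (S⁻¹ * a * S).BlockTriangular id) ↔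
      ∀ a ∈ 𝒜, ∀ b ∈ 𝒜, ∀ u ∈ 𝒜, Matrix.trace (a * b * u) = Matrix.trace (b * a * u) := by
  -- the family indexed by `𝒜` itself generates `𝒜`
  have hgen : Algebra.adjoin ℂ (Set.range (fun a : 𝒜 => (a : Matrix (Fin m) (Fin m) ℂ))) = 𝒜 := by
    rw [Subtype.range_coe_subtype]
    exact Algebra.adjoin_eq_of_le 𝒜 (fun a ha => ha) (fun a ha => Algebra.subset_adjoin ha)
  have key := exists_isUnit_conj_iff_traceOrth (fun a : 𝒜 => (a : Matrix (Fin m) (Fin m) ℂ))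
  rw [hgen] at key
  constructor
  · rintro ⟨S, hS, hT⟩ a ha b hb u hu
    have h0 := key.1 ⟨S, hS, fun k => hT k k.2⟩ ⟨a, ha⟩ ⟨b, hb⟩ u hu
    rw [Matrix.sub_mul, Matrix.trace_sub, sub_eq_zero] at h0
    exact h0
  · intro h
    obtain ⟨S, hS, hT⟩ := key.2 fun k l u hu => by
      rw [Matrix.sub_mul, Matrix.trace_sub, sub_eq_zero]
      exact h k k.2 l l.2 u hu
    exact ⟨S, hS, fun a ha => hT ⟨a, ha⟩⟩

/-! ## §3 The exchangeability lemma in full: a trace-orthogonal commutator gives a common FULL FLAG -/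

/-- The unital algebra generated by the pair `![X, Y]` is `ℂ⟨X, Y⟩`. -/
theorem adjoin_range_pair (X Y : Matrix (Fin m) (Fin m) ℂ) :
    Algebra.adjoin ℂ (Set.range ![X, Y]) = Algebra.adjoin ℂ ({X, Y} : Set (Matrix (Fin m) (Fin m) ℂ)) := by
  rw [Matrix.range_cons, Matrix.range_cons, Matrix.range_empty, Set.union_empty]
  rfl

/-- ★ **EXCHANGEABILITY LEMMA, FULL-FLAG FORM.**  If the commutator `XY − YX` is trace-orthogonal to the unital algebra
`ℂ⟨X, Y⟩` (e.g. if all word traces of `(X, Y)` are count-determined), then ONE non-singular `S` makes BOTH `S⁻¹XS` and `S⁻¹YS`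
upper triangular — `X` and `Y` share a complete flag of invariant subspaces (the 29th hand's
`BipartiteGraft.exists_common_eigenvector_of_commutator_traceOrth` is its first step). [cite: HornJohnson2013, Thm. 2.4.8.7] -/
theorem exists_isUnit_conj_pair_of_commutator_traceOrth (X Y : Matrix (Fin m) (Fin m) ℂ)
    (h : ∀ u ∈ Algebra.adjoin ℂ ({X, Y} : Set (Matrix (Fin m) (Fin m) ℂ)), Matrix.trace ((X * Y - Y * X) * u) = 0) :
    ∃ S : Matrix (Fin m) (Fin m) ℂ, IsUnit S ∧ (S⁻¹ * X * S).BlockTriangular id ∧ (S⁻¹ * Y * S).BlockTriangular id := by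
  have h' : ∀ k l, ∀ u ∈ Algebra.adjoin ℂ (Set.range ![X, Y]),
      Matrix.trace ((![X, Y] k * ![X, Y] l - ![X, Y] l * ![X, Y] k) * u) = 0 := by
    intro k l u hu
    rw [adjoin_range_pair] at hu
    fin_cases k <;> fin_cases l
    · simp
    · simpa using h u hu
    · have h1 := h u hu
      have e : (Y * X - X * Y) * u = -((X * Y - Y * X) * u) := by
        rw [← neg_sub, Matrix.neg_mul]
      simp only [Fin.mk_one, Fin.zero_eta, Matrix.cons_val_one, Matrix.cons_val_zero]
      rw [e, Matrix.trace_neg, h1, neg_zero]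
    · simp
  obtain ⟨S, hS, hT⟩ := exists_isUnit_conj_of_traceOrth ![X, Y] h'
  exact ⟨S, hS, by simpa using hT 0, by simpa using hT 1⟩

/-- Converse: a pair triangularised by one non-singular matrix has its commutator trace-orthogonal to `ℂ⟨X, Y⟩`.
[cite: HornJohnson2013, Thm. 2.4.8.7 (b) ⇒ (a)] -/
theorem commutator_traceOrth_of_exists_isUnit_conj_pair (X Y : Matrix (Fin m) (Fin m) ℂ)
    (h : ∃ S : Matrix (Fin m) (Fin m) ℂ, IsUnit S ∧ (S⁻¹ * X * S).BlockTriangular id ∧ (S⁻¹ * Y * S).BlockTriangular id) :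
    ∀ u ∈ Algebra.adjoin ℂ ({X, Y} : Set (Matrix (Fin m) (Fin m) ℂ)), Matrix.trace ((X * Y - Y * X) * u) = 0 := by
  obtain ⟨S, hS, hX, hY⟩ := h
  have hfam : ∃ S : Matrix (Fin m) (Fin m) ℂ, IsUnit S ∧ ∀ k, (S⁻¹ * ![X, Y] k * S).BlockTriangular id := by
    refine ⟨S, hS, fun k => ?_⟩
    fin_cases k
    · simpa using hX
    · simpa using hY
  intro u hu
  have h0 := traceOrth_of_exists_isUnit_conj ![X, Y] hfam 0 1 u (by rw [adjoin_range_pair]; exact hu)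
  simpa using h0

/-- ★ **EXCHANGEABILITY ⟺ ONE BOREL PAIR.**  `XY − YX` is trace-orthogonal to `ℂ⟨X, Y⟩` iff `X`, `Y` are simultaneously upper
triangularisable by one non-singular matrix. [cite: HornJohnson2013, Thm. 2.4.8.7] [cite: RadjaviRosenthal2000, Thm. 2.2.1] -/
theorem exists_isUnit_conj_pair_iff_commutator_traceOrth (X Y : Matrix (Fin m) (Fin m) ℂ) :
    (∃ S : Matrix (Fin m) (Fin m) ℂ, IsUnit S ∧ (S⁻¹ * X * S).BlockTriangular id ∧ (S⁻¹ * Y * S).BlockTriangular id) ↔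
      ∀ u ∈ Algebra.adjoin ℂ ({X, Y} : Set (Matrix (Fin m) (Fin m) ℂ)), Matrix.trace ((X * Y - Y * X) * u) = 0 :=
  ⟨commutator_traceOrth_of_exists_isUnit_conj_pair X Y, exists_isUnit_conj_pair_of_commutator_traceOrth X Y⟩

end Summit.ValiantsHypothesis.ValiantsHypothesis.Theorems.GrenetZeon.TraceTriangularisable
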